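import Summits.AtomisticToContinuum.Crystallization.Theorems.OverbindingBudgetAffineFarSlotRecord
import Summits.AtomisticToContinuum.Crystallization.Theorems.OverbindingBudgetAffineFarCoreWindow
import Summits.AtomisticToContinuum.Crystallization.Theorems.PalmUnimodularRigidityShellsToBarlowChartCubicGrowthAngle

/-!
# Overbinding budget — slot Z of the 31280 record, leaf Zr‴b `NormalCorePricing (1/25)`, part 1: chart geometry and NO CLUSTER

Tools for the proof of `NormalCorePricing (1/25)` (leaf list v14′ of the slot-Z record `farAggregatePricing_record_of_leaves_v14'`):

* §1 the metric constants of an ADMISSIBLE chart at distortion `1/25` (`ChartAdmissible (1/25) c`): `c.nn ≤ (28/25)·a₀` (a unit-norm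
  structure point exists) and the CHART SEPARATION `dist (a₀ B p) (a₀ B q) ≥ (11/14)·c.nn` of distinct structure points; read through an
  exact chart (`IsChart C ε₁ y i c`, `C ε₁ ≤ 1/100`) this is `≥ (7/10)·nn_i`.
* §2 the FRAME ESCAPE lemma: from an affinely framed site `m` (`AffFramed ε (1/25) g y m`, `ε ≤ 1/100`) and any point `x`, some framed
  neighbour `q` of `m` (within `(3/2)·nn_m`) is STRICTLY farther from `x` than `y m` is, by `≥ (1/2)·nn_m` — the covering angle `45°` of the
  cuboctahedron / anticuboctahedron (`fcc_coveringAngle`, `hcp_coveringAngle`) gives a first-shell frame vector within `45° + θ` of `y m − x`.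
* §3 NO CLUSTER (`chart_site_unique`): at a good site `i` (`goodSet 12 ε₁ (1/25) δ`) with an exact admissible chart, a structure point
  predicted within `(89/10)·nn_i` has AT MOST ONE configuration site within `C ε₁ nn_i` — two such sites would span a cluster of tiny nearest
  distance, affinely framed (deep registration at `i`), closed under frames (chart separation), whose diameter pair the escape lemma refutes.

[this file: Summit.AtomisticToContinuum.Crystallization, slot Z of the 31280 record, leaf Zr‴b, part 1]
-/

namespace Summit.AtomisticToContinuum.Crystallization.Theorems.OverbindingBudgetAffineFarSmoothSplit

open Literature.MathematicalPhysics.StatisticalMechanics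
open Literature.Geometry.DiscreteGeometry
open Summit.AtomisticToContinuum.Crystallization.Theorems.OverbindingBudgetAffineLadder
open Summit.AtomisticToContinuum.Crystallization.Theorems.OverbindingBudgetAffineLocalisation
open scoped Classical

variable {N : ℕ}

/-! ## §1  Metric constants of an admissible chart -/

/-- The reference nearest distance of an admissible chart is at most `(28/25)·a₀`: the origin shell of the stacking has a unit vector `e`,
and `c.nn ≤ a₀‖B e‖ ≤ (28/25) a₀`. [this file] -/
theorem ChartAdmissible.nn_le_scale {c : Chart} (h : ChartAdmissible (1 / 25) c) : c.nn ≤ 28 / 25 * c.a₀ := by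
  obtain ⟨hs, ha₀, -, hQ, hmin, -⟩ := h
  have hσ := cast_letter_eq hs 0
  have hτ := neg_cast_letter_eq hs (0 - 1)
  obtain ⟨e, he⟩ : (barlowShell (c.s 0 : ℝ) (-((c.s (0 - 1) : ℤ) : ℝ))).Nonempty :=
    Set.nonempty_of_ncard_ne_zero (by rw [ncard_barlowShell hσ hτ]; norm_num)
  have he1 : ‖e‖ = 1 := norm_eq_one_of_mem_barlowShell hσ hτ he
  have he0 : e ≠ 0 := by
    intro h0; rw [h0, norm_zero] at he1; exact zero_ne_one he1
  have h1 := hmin e (mem_of_mem_originShell hs he) he0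
  have h2 := (near_iso_bounds hQ).2 e
  rw [he1, mul_one] at h2
  have h3 : c.a₀ * ‖c.B e‖ ≤ c.a₀ * (28 / 25) := mul_le_mul_of_nonneg_left h2 ha₀.le
  linarith

/-- **Chart separation.**  Distinct structure points of an admissible chart are `(11/14)·c.nn` apart in the chart metric:
`‖p − q‖ ≥ 1`, `‖B(p − q)‖ ≥ (22/25)‖p − q‖`, `a₀ ≥ (25/28) c.nn`. [this file] -/
theorem ChartAdmissible.sep {c : Chart} (h : ChartAdmissible (1 / 25) c) {p q : EuclideanSpace ℝ (Fin 3)}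
    (hp : p ∈ barlowStacking 1 (Real.sqrt (2 / 3)) c.s) (hq : q ∈ barlowStacking 1 (Real.sqrt (2 / 3)) c.s) (hne : p ≠ q) :
    11 / 14 * c.nn ≤ dist (c.a₀ • c.B p) (c.a₀ • c.B q) := by
  have hs := h.1
  have ha₀ := h.2.1
  have h1 : (1 : ℝ) ≤ dist p q := by
    by_contra hlt
    push Not at hlt
    exact hne (eq_of_dist_lt_one hs hp hq hlt)
  have h2 := (near_iso_bounds h.2.2.2.1).1 (p - q)
  have h3 := h.nn_le_scale
  rw [dist_eq_norm, ← smul_sub, ← map_sub, norm_smul, Real.norm_of_nonneg ha₀.le]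
  rw [dist_eq_norm] at h1
  have h4 : c.a₀ * (22 / 25 * ‖p - q‖) ≤ c.a₀ * ‖c.B (p - q)‖ := mul_le_mul_of_nonneg_left h2 ha₀.le
  have h5 : c.a₀ * 1 ≤ c.a₀ * ‖p - q‖ := mul_le_mul_of_nonneg_left h1 ha₀.le
  linarith

/-- The chart's reference distance through an exact chart: `(1 − Cε₁) nn ≤ c.nn ≤ (1 + Cε₁) nn`. [this file] -/
theorem IsChart.nn_bounds {C ε₁ : ℝ} {y : Fin N → EuclideanSpace ℝ (Fin 3)} {i : Fin N} {c : Chart} (h : IsChart C ε₁ y i c) :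
    (1 - C * ε₁) * nearestDist y i ≤ c.nn ∧ c.nn ≤ (1 + C * ε₁) * nearestDist y i := by
  have h1 := abs_le.mp h.1
  constructor <;> linarith [h1.1, h1.2]

/-- **Chart separation in units of `nn_i`**: through an exact admissible chart with `C ε₁ ≤ 1/100`, distinct structure points are
`(7/10)·nn_i` apart. [this file] -/
theorem IsChart.sep {C ε₁ : ℝ} {y : Fin N → EuclideanSpace ℝ (Fin 3)} {i : Fin N} {c : Chart} (hchart : IsChart C ε₁ y i c)
    (hadm : ChartAdmissible (1 / 25) c) (hCε : C * ε₁ ≤ 1 / 100) {p q : EuclideanSpace ℝ (Fin 3)}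
    (hp : p ∈ barlowStacking 1 (Real.sqrt (2 / 3)) c.s) (hq : q ∈ barlowStacking 1 (Real.sqrt (2 / 3)) c.s) (hne : p ≠ q) :
    7 / 10 * nearestDist y i ≤ dist (c.a₀ • c.B p) (c.a₀ • c.B q) := by
  have h1 := hadm.sep hp hq hne
  have h2 := hchart.nn_bounds.1
  nlinarith [nearestDist_nonneg y i]

/-! ## §2  Frame escape: a framed neighbour farther from any given point -/

/-- **Frame escape.**  If `m` is affinely framed (`AffFramed ε (1/25) g y m`, `ε ≤ 1/100`, `nn_m > 0`), then for every point `x` some framed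
site `q` — within `(3/2)·nn_m` of `y m` — satisfies `dist (y q) x ≥ dist (y m) x + (1/2)·nn_m`.  The frame's first shell is the image of the
cuboctahedron or the anticuboctahedron, whose covering angle is `45°`: some first-shell vector `v` has `⟪y m − x, Q v⟫ ≥ ‖y m − x‖/√2`,
hence `⟪y m − x, A v⟫ ≥ (31/50)‖y m − x‖` and `‖(y m − x) + nn_m A v‖ ≥ ‖y m − x‖ + (3/5) nn_m`. [this file] -/
theorem frame_escape {ε g : ℝ} {y : Fin N → EuclideanSpace ℝ (Fin 3)} {m : Fin N} (hfr : AffFramed ε (1 / 25) g y m)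
    (hε : ε ≤ 1 / 100) (hnn : 0 < nearestDist y m) (x : EuclideanSpace ℝ (Fin 3)) :
    ∃ q : Fin N, dist (y q) (y m) ≤ 3 / 2 * nearestDist y m ∧ dist (y m) x + 1 / 2 * nearestDist y m ≤ dist (y q) x := by
  obtain ⟨Q, A, P, f, hP, hAQ, hfit, -, -⟩ := hfr
  set d := y m - x with hd_def
  set Qe := Q.toLinearIsometryEquiv rfl with hQe_def
  have hQe : ∀ v, Qe v = Q v := fun v => rfl
  -- a first-shell frame vector within `45°` of `Q⁻¹ d`
  obtain ⟨v, hv1, hvP, hcap⟩ : ∃ v, ‖v‖ = 1 ∧ v ∈ P ∧ ‖Qe.symm d‖ ≤ Real.sqrt 2 * inner ℝ (Qe.symm d) v := by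
    rcases hP with rfl | rfl
    · obtain ⟨v, hv, h⟩ := PalmUnimodularRigidityShellsToBarlowChart.fcc_coveringAngle (Qe.symm d)
      exact ⟨v, norm_eq_one_of_mem_fccKissingPattern hv, fccKissingPattern_subset hv, h⟩
    · obtain ⟨v, hv, h⟩ := PalmUnimodularRigidityShellsToBarlowChart.hcp_coveringAngle (Qe.symm d)
      exact ⟨v, norm_eq_one_of_mem_hcpKissingPattern hv, hcpKissingPattern_subset hv, h⟩
  have hinner : ‖d‖ ≤ Real.sqrt 2 * inner ℝ d (Q v) := by
    have e1 : inner ℝ (Qe.symm d) v = inner ℝ d (Q v) := by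
      rw [← Qe.inner_map_map (Qe.symm d) v, LinearIsometryEquiv.apply_symm_apply, hQe]
    rw [← Qe.symm.norm_map d, ← e1]
    exact hcap
  have hAQv := hAQ v hvP
  have hQv : ‖Q v‖ = 1 := by rw [Q.norm_map, hv1]
  have hAv_le : ‖A v‖ ≤ 26 / 25 := by
    have := norm_le_insert' (A v) (Q v); linarith
  have hAv_ge : 24 / 25 ≤ ‖A v‖ := by
    have := norm_le_insert' (Q v) (A v); rw [norm_sub_rev] at this; linarith
  -- `⟪d, A v⟫ ≥ (31/50)‖d‖`
  have hdA : 31 / 50 * ‖d‖ ≤ inner ℝ d (A v) := by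
    have h1 : inner ℝ d (A v) = inner ℝ d (Q v) + inner ℝ d (A v - Q v) := by
      rw [← inner_add_right, add_sub_cancel]
    have h2 : |inner ℝ d (A v - Q v)| ≤ ‖d‖ * ‖A v - Q v‖ := abs_real_inner_le_norm _ _
    have h3 : ‖d‖ * ‖A v - Q v‖ ≤ ‖d‖ * (1 / 25) := mul_le_mul_of_nonneg_left hAQv (norm_nonneg _)
    have h4 := (abs_le.mp (h2.trans h3)).1
    have h5 : 2 / 3 * ‖d‖ ≤ inner ℝ d (Q v) := by
      have h6 : Real.sqrt 2 * inner ℝ d (Q v) ≤ 3 / 2 * inner ℝ d (Q v) := by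
        by_cases hq : 0 ≤ inner ℝ d (Q v)
        · exact mul_le_mul_of_nonneg_right ((Real.sqrt_le_left (by norm_num)).mpr (by norm_num)) hq
        · push Not at hq
          have : ‖d‖ < 0 := lt_of_le_of_lt hinner (mul_neg_of_pos_of_neg (by positivity) hq)
          exact absurd this (not_lt.mpr (norm_nonneg d))
      linarith
    rw [h1]; linarith [norm_nonneg d]
  -- the framed site `q` with `y q = f v`
  obtain ⟨⟨q, hq⟩, hfv⟩ := hfit v hvP
  refine ⟨q, ?_, ?_⟩
  · rw [hq]
    calc dist (f v) (y m) ≤ dist (f v) (y m + nearestDist y m • A v) + dist (y m + nearestDist y m • A v) (y m) := dist_triangle _ _ _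
      _ ≤ ε * nearestDist y m + nearestDist y m * ‖A v‖ := by
          refine add_le_add hfv (le_of_eq ?_)
          rw [dist_eq_norm, add_sub_cancel_left, norm_smul, Real.norm_of_nonneg hnn.le]
      _ ≤ 3 / 2 * nearestDist y m := by nlinarith
  · have hsq : (‖d‖ + 3 / 5 * nearestDist y m) ^ 2 ≤ ‖d + nearestDist y m • A v‖ ^ 2 := by
      have hexp : ‖d + nearestDist y m • A v‖ ^ 2 =
          ‖d‖ ^ 2 + 2 * (nearestDist y m * inner ℝ d (A v)) + nearestDist y m ^ 2 * ‖A v‖ ^ 2 := by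
        rw [← real_inner_self_eq_norm_sq, real_inner_add_add_self, real_inner_self_eq_norm_sq, real_inner_smul_right,
          real_inner_smul_left, real_inner_smul_right, real_inner_self_eq_norm_sq]; ring
      rw [hexp]
      have h1 : nearestDist y m * (31 / 50 * ‖d‖) ≤ nearestDist y m * inner ℝ d (A v) := mul_le_mul_of_nonneg_left hdA hnn.le
      have h2 : (24 / 25 : ℝ) ^ 2 ≤ ‖A v‖ ^ 2 := pow_le_pow_left₀ (by norm_num) hAv_ge 2
      have h3 : nearestDist y m ^ 2 * (24 / 25 : ℝ) ^ 2 ≤ nearestDist y m ^ 2 * ‖A v‖ ^ 2 :=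
        mul_le_mul_of_nonneg_left h2 (sq_nonneg _)
      nlinarith [norm_nonneg d]
    have h4 : ‖d‖ + 3 / 5 * nearestDist y m ≤ ‖d + nearestDist y m • A v‖ :=
      le_of_pow_le_pow_left₀ two_ne_zero (norm_nonneg _) hsq
    have h5 : ‖d + nearestDist y m • A v‖ ≤ ‖d + nearestDist y m • A v + (f v - (y m + nearestDist y m • A v))‖ +
        ‖f v - (y m + nearestDist y m • A v)‖ := by
      have := norm_sub_le (d + nearestDist y m • A v + (f v - (y m + nearestDist y m • A v))) (f v - (y m + nearestDist y m • A v))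
      rwa [add_sub_cancel_right] at this
    have h6 : ‖f v - (y m + nearestDist y m • A v)‖ ≤ ε * nearestDist y m := by rw [← dist_eq_norm]; exact hfv
    have h7 : dist (y q) x = ‖d + nearestDist y m • A v + (f v - (y m + nearestDist y m • A v))‖ := by
      rw [hq, dist_eq_norm, hd_def]; congr 1; abel
    rw [h7, dist_eq_norm]
    nlinarith

/-! ## §3  No cluster: a predicted structure point is matched by at most one site -/

/-- **Cluster closure.**  At a good site `i` with an exact admissible chart (`C ε₁ ≤ 1/100`) and a structure point `p` predicted within
`(89/10)·nn_i`: if a site `m` within `C ε₁ nn_i` of the prediction `y i + a₀ B p` has `nn_m ≤ 2 C ε₁ nn_i`, then every site within `(3/2)·nn_m`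
of `y m` is again within `C ε₁ nn_i` of the prediction — it is `C ε₁ nn_i`-near SOME predicted structure point (exactness), which the chart
separation forces to be `p`. [this file] -/
theorem cluster_closed {C ε₁ δ : ℝ} {y : Fin N → EuclideanSpace ℝ (Fin 3)} {i : Fin N} (hiG : i ∈ goodSet 12 ε₁ (1 / 25) δ y)
    (hδ : 0 < δ) (hCε : C * ε₁ ≤ 1 / 100) {c : Chart} (hchart : IsChart C ε₁ y i c)
    (hadm : ChartAdmissible (1 / 25) c) {p : EuclideanSpace ℝ (Fin 3)} (hp : p ∈ barlowStacking 1 (Real.sqrt (2 / 3)) c.s)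
    (hp9 : ‖c.a₀ • c.B p‖ ≤ 89 / 10 * nearestDist y i) {m : Fin N}
    (hm : dist (y m) (y i + c.a₀ • c.B p) ≤ C * ε₁ * nearestDist y i) (hnnm : nearestDist y m ≤ 2 * (C * ε₁ * nearestDist y i))
    {q : Fin N} (hq : dist (y q) (y m) ≤ 3 / 2 * nearestDist y m) :
    dist (y q) (y i + c.a₀ • c.B p) ≤ C * ε₁ * nearestDist y i := by
  have hnn : 0 < nearestDist y i := lt_of_lt_of_le hδ (inWindow_of_mem_goodSet hiG).1
  have hz : dist (y i + c.a₀ • c.B p) (y i) = ‖c.a₀ • c.B p‖ := by rw [dist_eq_norm, add_sub_cancel_left]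
  have hqz : dist (y q) (y i + c.a₀ • c.B p) ≤ 4 * (C * ε₁ * nearestDist y i) := by
    calc dist (y q) (y i + c.a₀ • c.B p) ≤ dist (y q) (y m) + dist (y m) (y i + c.a₀ • c.B p) := dist_triangle _ _ _
      _ ≤ 3 / 2 * nearestDist y m + C * ε₁ * nearestDist y i := add_le_add hq hm
      _ ≤ 4 * (C * ε₁ * nearestDist y i) := by linarith
  have hq9 : dist (y q) (y i) ≤ 9 * nearestDist y i := by
    calc dist (y q) (y i) ≤ dist (y q) (y i + c.a₀ • c.B p) + dist (y i + c.a₀ • c.B p) (y i) := dist_triangle _ _ _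
      _ ≤ 4 * (C * ε₁ * nearestDist y i) + 89 / 10 * nearestDist y i := by rw [hz]; exact add_le_add hqz hp9
      _ ≤ 9 * nearestDist y i := by nlinarith
  obtain ⟨p', hp', hqp'⟩ := hchart.2.1 q hq9
  by_cases hpp' : p' = p
  · rw [hpp'] at hqp'; exact hqp'
  · exfalso
    have hsep := hchart.sep hadm hCε hp' hp hpp'
    have h1 : dist (c.a₀ • c.B p') (c.a₀ • c.B p) ≤ dist (y q) (y i + c.a₀ • c.B p') + dist (y q) (y i + c.a₀ • c.B p) := by
      rw [← dist_add_left (y i) (c.a₀ • c.B p') (c.a₀ • c.B p)]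
      exact dist_triangle_left _ _ _
    nlinarith

/-- **NO CLUSTER (site uniqueness of the chart matching).**  At a good site `i` (`goodSet 12 ε₁ (1/25) δ`, so every site within `12·nn_i` is
affinely framed) with an exact admissible chart (`IsChart C ε₁ y i c`, `ChartAdmissible (1/25) c`, `C ε₁ ≤ 1/100`, `ε₁ ≤ 1/100`), a structure
point `p` predicted within `(89/10)·nn_i` has at most ONE configuration site within `C ε₁ nn_i` of its prediction.  Two such sites `k ≠ k'`
would span the cluster `S` of all sites that near; its members have `nn ≤ 2Cε₁nn_i`, are framed, and `S` is closed under frames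
(`cluster_closed`); for a pair `(m₁, m₂)` of `S` at maximal distance the escape lemma (`frame_escape`) produces a framed neighbour of `m₁` in `S`
strictly farther from `y m₂` — contradiction. [this file] -/
theorem chart_site_unique {C ε₁ δ : ℝ} {y : Fin N → EuclideanSpace ℝ (Fin 3)} (hy : Function.Injective y) {i : Fin N}
    (hiG : i ∈ goodSet 12 ε₁ (1 / 25) δ y) (hδ : 0 < δ) (hε : ε₁ ≤ 1 / 100) (hCε : C * ε₁ ≤ 1 / 100)
    {c : Chart} (hchart : IsChart C ε₁ y i c) (hadm : ChartAdmissible (1 / 25) c)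
    {p : EuclideanSpace ℝ (Fin 3)} (hp : p ∈ barlowStacking 1 (Real.sqrt (2 / 3)) c.s) (hp9 : ‖c.a₀ • c.B p‖ ≤ 89 / 10 * nearestDist y i)
    {k k' : Fin N} (hk : dist (y k) (y i + c.a₀ • c.B p) ≤ C * ε₁ * nearestDist y i)
    (hk' : dist (y k') (y i + c.a₀ • c.B p) ≤ C * ε₁ * nearestDist y i) : k = k' := by
  by_contra hne
  have hnn : 0 < nearestDist y i := lt_of_lt_of_le hδ (inWindow_of_mem_goodSet hiG).1
  have hG := hiG
  unfold goodSet at hG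
  rw [Finset.mem_filter] at hG
  obtain ⟨-, hdeep, -⟩ := hG
  have hz : dist (y i + c.a₀ • c.B p) (y i) = ‖c.a₀ • c.B p‖ := by rw [dist_eq_norm, add_sub_cancel_left]
  -- the cluster
  set S : Finset (Fin N) := Finset.univ.filter fun m => dist (y m) (y i + c.a₀ • c.B p) ≤ C * ε₁ * nearestDist y i with hS
  have hmemS : ∀ m, m ∈ S ↔ dist (y m) (y i + c.a₀ • c.B p) ≤ C * ε₁ * nearestDist y i := fun m => by
    rw [hS, Finset.mem_filter]; exact ⟨fun h => h.2, fun h => ⟨Finset.mem_univ _, h⟩⟩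
  have hkS : k ∈ S := (hmemS k).2 hk
  have hk'S : k' ∈ S := (hmemS k').2 hk'
  have hSd : ∀ m ∈ S, ∀ m' ∈ S, dist (y m) (y m') ≤ 2 * (C * ε₁ * nearestDist y i) := fun m hm m' hm' => by
    have h1 := (hmemS m).1 hm
    have h2 := (hmemS m').1 hm'
    linarith [dist_triangle_right (y m) (y m') (y i + c.a₀ • c.B p)]
  have hSnn : ∀ m ∈ S, nearestDist y m ≤ 2 * (C * ε₁ * nearestDist y i) := by
    intro m hm
    by_cases hmk : m = k
    · have h1 : k' ≠ m := fun e => hne (hmk.symm.trans e.symm)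
      exact (nearestDist_le_dist y h1).trans (hSd m hm k' hk'S)
    · have h1 : k ≠ m := fun e => hmk e.symm
      exact (nearestDist_le_dist y h1).trans (hSd m hm k hkS)
  have hS12 : ∀ m ∈ S, dist (y m) (y i) ≤ 12 * nearestDist y i := by
    intro m hm
    have h1 := (hmemS m).1 hm
    have h2 := dist_triangle (y m) (y i + c.a₀ • c.B p) (y i)
    rw [hz] at h2
    nlinarith
  -- a pair at maximal distance
  have hSne : (S ×ˢ S).Nonempty := ⟨(k, k'), Finset.mk_mem_product hkS hk'S⟩
  obtain ⟨mm, hmm, hmax⟩ := Finset.exists_max_image (S ×ˢ S) (fun mm : Fin N × Fin N => dist (y mm.1) (y mm.2)) hSne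
  obtain ⟨m₁, m₂⟩ := mm
  rw [Finset.mem_product] at hmm
  obtain ⟨hm₁, hm₂⟩ := hmm
  have hDk : dist (y k) (y k') ≤ dist (y m₁) (y m₂) := hmax (k, k') (Finset.mk_mem_product hkS hk'S)
  have hDpos : 0 < dist (y m₁) (y m₂) := lt_of_lt_of_le (dist_pos.mpr fun e => hne (hy e)) hDk
  have hm21 : m₂ ≠ m₁ := by
    intro e; rw [e, dist_self] at hDpos; exact lt_irrefl _ hDpos
  have hnn1 : 0 < nearestDist y m₁ := by
    obtain ⟨k₀, hk₀, h⟩ := exists_nearestDist_eq_dist y ⟨m₂, hm21⟩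
    rw [h]; exact dist_pos.mpr fun e => hk₀ (hy e).symm
  -- escape from `m₁` away from `y m₂`
  obtain ⟨q, hq1, hq2⟩ := frame_escape (hdeep m₁ (hS12 m₁ hm₁)).2 hε hnn1 (y m₂)
  have hqS : q ∈ S := (hmemS q).2 (cluster_closed hiG hδ hCε hchart hadm hp hp9 ((hmemS m₁).1 hm₁) (hSnn m₁ hm₁) hq1)
  have hle : dist (y q) (y m₂) ≤ dist (y m₁) (y m₂) := hmax (q, m₂) (Finset.mk_mem_product hqS hm₂)
  linarith

end Summit.AtomisticToContinuum.Crystallization.Theorems.OverbindingBudgetAffineFarSmoothSplit
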